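import Literature.NumberTheory.GelbartRogawski1991.DoubledBlockDiagEmbedding
import Literature.NumberTheory.GelbartRogawski1991.DoubledSeesawParabolic
import Literature.NumberTheory.GelbartRogawski1991.DoubledWeilRepresentationUndoublingConj
import Literature.NumberTheory.GelbartRogawski1991.DoubledWeilRepresentationUndoublingTensor
import Literature.NumberTheory.Automorphic.Liu2021.Def411WeilCarriersDoubling
import HarnessLib

/-!
# Undoubling the see-saw of the `χ`-normalised doubled Weil representations along `ι_V = blkD ∘ (ι_{V₁} × ι_{V₂})`

Setting: `V = V₁ ⊕ V₂` diagonal hermitian over a CM field `L` (`dV = dA ‖ dB`), partner `W = diag dW`, enumerations `eV, eA, eB`,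
`ι = idxSplit eV eA eB : Fin n ≃ Fin n₁ ⊕ Fin n₂`, `σ = idxSplitD eV eA eB` (`DoubledBlockDiagEmbedding`); the `χ`-attached
compatible splittings `s_χ^X = chiSplitting` of `G₁(X)(𝔸) = U(X ⊗ W)(𝔸_{L⁺})`, `X ∈ {V, V₁}`, obtained from the `χ`-normalised doubled
Weil representations by restriction along `ι_X : g ↦ g ⊕ 1` and UNDOUBLING ([Kudla1994, §2]: `ω^𝔻(ι g)(Φ ⊠ Φ′) = ω(s g)Φ ⊠ Φ′`,
the tree's `omega_uD_tensorToSum`).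

* §U1 coordinates: `R_{e_V}(Φ₁ ⊠_{e_Σ} Φ₂) = R_{e₁}Φ₁ ⊠_ι R_{e₂}Φ₂`, its inverse form, and the 4-fold shuffle
  `(R⁻¹(Φ₁ ⊠ G₁)) ⊠_σ (R⁻¹(Φ₂ ⊠ G₂)) = R⁻¹((Φ₁ ⊠_ι Φ₂) ⊠ (G₁ ⊠_ι G₂))`;
* §U2 the group identity `ι_V(X) = blkD (ι_{V₁} X₁, ι_{V₂} X₂)` whenever `reindex e_Σ e_Σ X = diag(X₁, X₂)` — the see-saw square
  `G₁(V₁) × G₁(V₂) → G₁(V) → H(V)` = `→ H(V₁) × H(V₂) → H(V)` on the nose ([Kudla1984, §1]);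
* §U3 **`omega_chiSplitting_sumTensor_idxSplit`** — for `reindex e_Σ e_Σ X = diag(X₁, 1)`,
  `ω(s_χ^V X) (Φ₁ ⊠_ι Φ₂) = ω(s_χ^{V₁} X₁) Φ₁ ⊠_ι Φ₂` for ALL `Φ₁, Φ₂`: the doubled conclusion `omega_blkD_inl_sumTensor`
  (`DoubledSeesawParabolic`: the see-saw character of the doubled triple is `1` on `H(V₁)(𝔸) × 1`) at `Ψ_j := R⁻¹(Φ_j ⊠ Θ-witness)`,
  the two undoubling product formulas, the shuffle, and `⊠ T`-cancellation at `T := witness ⊠_ι witness ≠ 0`.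

This is the see-saw step «the restriction of `ω_{μ,ε}` to `U(V⋆)` … with the same `μ`» of the proof of [Liu2021, Thm. 4.15]
(l. 2199–2210) for the `χ`-normalised splittings, in enumerated coordinates; the Kronecker-coordinate statement over a hermitian
line is `Liu2021/Def411WeilCarriersDoublingSeesawLine`.

References: [Kudla1994] S. Kudla, Israel J. Math. 87 (1994) §2, Thm. 3.1; [Kudla1984] S. Kudla, Progr. Math. 46 (1984) §1;
[MoeglinVignerasWaldspurger1987] C. Mœglin, M.-F. Vignéras, J.-L. Waldspurger, LNM 1291 (1987) Chap. 2 II.1; [GelbartRogawski1991]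
Invent. Math. 105 (1991) §3.1 Prop. 3.1.1 p. 455, Remark p. 457; [Liu2021] Y. Liu, Camb. J. Math. 9 (2021), proof of Thm. 4.15.
-/

set_option autoImplicit false

noncomputable section

open scoped Classical
open scoped Matrix Kronecker
open NumberField IsDedekindDomain
open Literature.RepresentationTheory.HeisenbergGroup
open Literature.NumberTheory.Automorphic
open Literature.NumberTheory.Weil1964
open Literature.RepresentationTheory.HarrisKudlaSweet1996
open Literature.NumberTheory.GaloisRepresentations

namespace Literature.NumberTheory.GelbartRogawski1991.GRConstruction

open UnitaryDualPair
open Literature.NumberTheory.Automorphic.Liu2021.Def411WeilCarriersDoubling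

/-! ## §U1 Coordinates: the enumerations and the 4-fold shuffle of test functions -/

section Coordinates

variable (F : Type) [Field F] [NumberField F]
variable {N₁ N₂ M n n₁ n₂ : ℕ} (eV : Fin (N₁ + N₂) × Fin M ≃ Fin n) (eA : Fin N₁ × Fin M ≃ Fin n₁)
  (eB : Fin N₂ × Fin M ≃ Fin n₂)

/-- **`R_{e_V}(Φ₁ ⊠_{e_Σ} Φ₂) = R_{e₁}Φ₁ ⊠_ι R_{e₂}Φ₂`**: the Kronecker-coordinate sum tensor along
`e_Σ = (finSumFinEquiv × 1)⁻¹ ≫ Equiv.sumProdDistrib`, enumerated by `e_V`, is the enumerated sum tensor along `ι = idxSplit`.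
[cite: Kudla1984, §1] -/
theorem piSBReindex_sumTensor_kronecker (Φ₁ : piSchwartzBruhat F (Fin N₁ × Fin M)) (Φ₂ : piSchwartzBruhat F (Fin N₂ × Fin M)) :
    piSBReindex F eV (sumTensor F ((finSumFinEquiv.prodCongr (Equiv.refl (Fin M))).symm.trans
        (Equiv.sumProdDistrib (Fin N₁) (Fin N₂) (Fin M))) Φ₁ Φ₂) =
      sumTensor F (idxSplit eV eA eB) (piSBReindex F eA Φ₁) (piSBReindex F eB Φ₂) := by
  apply Subtype.ext
  funext u
  simp only [coe_piSBReindex_apply, coe_sumTensor_apply]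
  refine congrArg₂ (· * ·) (congrArg _ (funext fun i => ?_)) (congrArg _ (funext fun k => ?_))
  · obtain ⟨a, b⟩ := i
    simp [idxSplit]
  · obtain ⟨a, b⟩ := k
    simp [idxSplit]

/-- the inverse form: `R_{e_V}⁻¹(Ψ₁ ⊠_ι Ψ₂) = R_{e₁}⁻¹Ψ₁ ⊠_{e_Σ} R_{e₂}⁻¹Ψ₂`. [cite: Kudla1984, §1] -/
theorem piSBReindex_symm_sumTensor_idxSplit (Ψ₁ : piSchwartzBruhat F (Fin n₁)) (Ψ₂ : piSchwartzBruhat F (Fin n₂)) :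
    (piSBReindex F eV).symm (sumTensor F (idxSplit eV eA eB) Ψ₁ Ψ₂) =
      sumTensor F ((finSumFinEquiv.prodCongr (Equiv.refl (Fin M))).symm.trans
        (Equiv.sumProdDistrib (Fin N₁) (Fin N₂) (Fin M))) ((piSBReindex F eA).symm Ψ₁) ((piSBReindex F eB).symm Ψ₂) := by
  rw [LinearEquiv.symm_apply_eq, piSBReindex_sumTensor_kronecker, LinearEquiv.apply_symm_apply, LinearEquiv.apply_symm_apply]

/-- **the 4-fold shuffle**: `(R_{e₂}⁻¹)⁻¹`-images of two doubled pure tensors, summed along `σ = idxSplitD`, are the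
`(R_{e₂}⁻¹)⁻¹`-image of the doubled pure tensor of the two `ι`-sums:
`(R⁻¹(Φ₁ ⊠ G₁)) ⊠_σ (R⁻¹(Φ₂ ⊠ G₂)) = R⁻¹((Φ₁ ⊠_ι Φ₂) ⊠ (G₁ ⊠_ι G₂))` (`𝕎_V ⊕ 𝕎_V⁻ = (𝕎_{V₁} ⊕ 𝕎_{V₁}⁻) ⊕ (𝕎_{V₂} ⊕ 𝕎_{V₂}⁻)`).
[cite: Kudla1984, §1] [cite: Kudla1994, §2 (doubled space, Siegel parabolic)] -/
theorem sumTensor_idxSplitD_tensorToSum (Φ₁ G₁ : piSchwartzBruhat F (Fin n₁)) (Φ₂ G₂ : piSchwartzBruhat F (Fin n₂)) :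
    sumTensor F (idxSplitD eV eA eB)
        ((piSBReindex F (finSumFinEquiv (m := n₁) (n := n₁)).symm).symm (tensorToSum F (Fin n₁) (Fin n₁) Φ₁ G₁))
        ((piSBReindex F (finSumFinEquiv (m := n₂) (n := n₂)).symm).symm (tensorToSum F (Fin n₂) (Fin n₂) Φ₂ G₂)) =
      (piSBReindex F (finSumFinEquiv (m := n) (n := n)).symm).symm
        (tensorToSum F (Fin n) (Fin n) (sumTensor F (idxSplit eV eA eB) Φ₁ Φ₂) (sumTensor F (idxSplit eV eA eB) G₁ G₂)) := by
  apply Subtype.ext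
  funext w
  simp only [coe_sumTensor_apply, coe_piSBReindex_symm_apply, Equiv.symm_symm, coe_tensorToSum, boxTensor_apply,
    Function.comp_apply, idxSplitD_symm_inl_inl, idxSplitD_symm_inl_inr, idxSplitD_symm_inr_inl, idxSplitD_symm_inr_inr]
  exact mul_mul_mul_comm _ _ _ _

end Coordinates

/-! ## §U2 The group identity `ι_V(X) = blkD (ι_{V₁} X₁, ι_{V₂} X₂)` -/

section GroupIdentity

variable (L : Type) [Field L] [NumberField L] [IsCMField L]

local notation "𝔸L" => AdeleRing (𝓞 L) L

/-- the entries of `ι^𝔻(Y) = Y ⊕ 1` in the block enumeration: `(ι Y)(e₂ z, e₂ z') = diag(reindex e e Y, 1) z z'`.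
[cite: Kudla1994, §2 (doubled space, Siegel parabolic)] -/
theorem coe_coe_inlG_apply {N M n : ℕ} (e : Fin N × Fin M ≃ Fin n) (d : Fin N → L)
    (hd : ∀ i, IsCMField.complexConj L (d i) = d i) (dW : Fin M → L) (hdW : ∀ i, IsCMField.complexConj L (dW i) = dW i)
    (Y : ↥(UnitaryGroup.adelicPair (Fp L) L (IsCMField.complexConj L) N M (Matrix.diagonal d) (Matrix.diagonal dW)))
    (z z' : Fin n ⊕ Fin n) :
    (((inlG L e d hd dW hdW Y : HA L e d hd dW hdW) : GL (Fin (n + n)) 𝔸L) : Matrix (Fin (n + n)) (Fin (n + n)) 𝔸L)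
        (finSumFinEquiv z) (finSumFinEquiv z') =
      Matrix.fromBlocks (Matrix.reindex e e ((Y : GL (Fin N × Fin M) 𝔸L) : Matrix (Fin N × Fin M) (Fin N × Fin M) 𝔸L))
        0 0 1 z z' := by
  rw [coe_inlG, UnitaryGroup.coe_reindexGL, UnitaryGroup.coe_blockDiagGL, Matrix.reindex_apply, Matrix.submatrix_apply,
    Equiv.symm_apply_apply, Equiv.symm_apply_apply, UnitaryGroup.coe_reindexGL, Units.val_one]

variable {N₁ N₂ M n n₁ n₂ : ℕ} (eV : Fin (N₁ + N₂) × Fin M ≃ Fin n) (eA : Fin N₁ × Fin M ≃ Fin n₁)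
  (eB : Fin N₂ × Fin M ≃ Fin n₂)
  (dA : Fin N₁ → L) (hdA : ∀ i, IsCMField.complexConj L (dA i) = dA i)
  (dB : Fin N₂ → L) (hdB : ∀ i, IsCMField.complexConj L (dB i) = dB i)
  (dV : Fin (N₁ + N₂) → L) (hdV : ∀ i, IsCMField.complexConj L (dV i) = dV i)
  (hVA : ∀ i, dV (Fin.castAdd N₂ i) = dA i) (hVB : ∀ j, dV (Fin.natAdd N₁ j) = dB j)
  (dW : Fin M → L) (hdW : ∀ i, IsCMField.complexConj L (dW i) = dW i)

/-- **`ι_V(X) = blkD (ι_{V₁} X₁, ι_{V₂} X₂)`** in `H(V)(𝔸)` for `X ∈ G₁(V)(𝔸)`, `X_j ∈ G₁(V_j)(𝔸)` with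
`reindex e_Σ e_Σ X = diag(X₁, X₂)` — the see-saw square `G₁(V₁) × G₁(V₂) → G₁(V) → H(V)` = `→ H(V₁) × H(V₂) → H(V)` on the nose.
[cite: Kudla1984, §1] [cite: Kudla1994, §2 (doubled space, Siegel parabolic)] -/
theorem inlG_eq_blkD
    (X : ↥(UnitaryGroup.adelicPair (Fp L) L (IsCMField.complexConj L) (N₁ + N₂) M (Matrix.diagonal dV) (Matrix.diagonal dW)))
    (X₁ : ↥(UnitaryGroup.adelicPair (Fp L) L (IsCMField.complexConj L) N₁ M (Matrix.diagonal dA) (Matrix.diagonal dW)))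
    (X₂ : ↥(UnitaryGroup.adelicPair (Fp L) L (IsCMField.complexConj L) N₂ M (Matrix.diagonal dB) (Matrix.diagonal dW)))
    (hX : Matrix.reindex
        ((finSumFinEquiv.prodCongr (Equiv.refl (Fin M))).symm.trans (Equiv.sumProdDistrib (Fin N₁) (Fin N₂) (Fin M)))
        ((finSumFinEquiv.prodCongr (Equiv.refl (Fin M))).symm.trans (Equiv.sumProdDistrib (Fin N₁) (Fin N₂) (Fin M)))
        ((X : GL (Fin (N₁ + N₂) × Fin M) 𝔸L) : Matrix (Fin (N₁ + N₂) × Fin M) (Fin (N₁ + N₂) × Fin M) 𝔸L) =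
      Matrix.fromBlocks ((X₁ : GL (Fin N₁ × Fin M) 𝔸L) : Matrix (Fin N₁ × Fin M) (Fin N₁ × Fin M) 𝔸L) 0 0
        ((X₂ : GL (Fin N₂ × Fin M) 𝔸L) : Matrix (Fin N₂ × Fin M) (Fin N₂ × Fin M) 𝔸L)) :
    inlG L eV dV hdV dW hdW X =
      blkD L eV eA eB dA hdA dB hdB dV hdV hVA hVB dW hdW (inlG L eA dA hdA dW hdW X₁, inlG L eB dB hdB dW hdW X₂) := by
  -- the entries of `X` through `e_Σ`
  have hX' : ∀ a b : Fin (N₁ + N₂) × Fin M,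
      ((X : GL (Fin (N₁ + N₂) × Fin M) 𝔸L) : Matrix (Fin (N₁ + N₂) × Fin M) (Fin (N₁ + N₂) × Fin M) 𝔸L) a b =
        Matrix.fromBlocks ((X₁ : GL (Fin N₁ × Fin M) 𝔸L) : Matrix (Fin N₁ × Fin M) (Fin N₁ × Fin M) 𝔸L) 0 0
          ((X₂ : GL (Fin N₂ × Fin M) 𝔸L) : Matrix (Fin N₂ × Fin M) (Fin N₂ × Fin M) 𝔸L)
          (((finSumFinEquiv.prodCongr (Equiv.refl (Fin M))).symm.trans (Equiv.sumProdDistrib (Fin N₁) (Fin N₂) (Fin M))) a)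
          (((finSumFinEquiv.prodCongr (Equiv.refl (Fin M))).symm.trans (Equiv.sumProdDistrib (Fin N₁) (Fin N₂) (Fin M))) b) :=
    fun a b => by
      rw [← hX, Matrix.reindex_apply, Matrix.submatrix_apply, Equiv.symm_apply_apply, Equiv.symm_apply_apply]
  apply Subtype.ext
  apply Units.ext
  ext i j
  obtain ⟨z, rfl⟩ := (finSumFinEquiv (m := n) (n := n)).surjective i
  obtain ⟨z', rfl⟩ := (finSumFinEquiv (m := n) (n := n)).surjective j
  rw [coe_coe_inlG_apply, coe_coe_blkD_apply]
  rcases z with k | k <;> rcases z' with k' | k' <;>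
    obtain ⟨w, rfl⟩ := (idxSplit eV eA eB).symm.surjective k <;>
    obtain ⟨w', rfl⟩ := (idxSplit eV eA eB).symm.surjective k' <;>
    simp only [idxSplitD_apply_inl, idxSplitD_apply_inr, Equiv.apply_symm_apply] <;>
    rcases w with m | m <;> rcases w' with m' | m' <;>
    simp only [Sum.map_inl, Sum.map_inr, Matrix.fromBlocks_apply₁₁, Matrix.fromBlocks_apply₁₂, Matrix.fromBlocks_apply₂₁,
      Matrix.fromBlocks_apply₂₂, coe_coe_inlG_apply] <;>
    simp [hX', eV_symm_idxSplit_symm_inl, eV_symm_idxSplit_symm_inr, Matrix.one_apply]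

/-- the case `X₂ = 1`: `ι_V(X) = blkD (ι_{V₁} X₁, 1)` for `reindex e_Σ e_Σ X = diag(X₁, 1)`. [cite: Kudla1984, §1] -/
theorem inlG_eq_blkD_one
    (X : ↥(UnitaryGroup.adelicPair (Fp L) L (IsCMField.complexConj L) (N₁ + N₂) M (Matrix.diagonal dV) (Matrix.diagonal dW)))
    (X₁ : ↥(UnitaryGroup.adelicPair (Fp L) L (IsCMField.complexConj L) N₁ M (Matrix.diagonal dA) (Matrix.diagonal dW)))
    (hX : Matrix.reindex
        ((finSumFinEquiv.prodCongr (Equiv.refl (Fin M))).symm.trans (Equiv.sumProdDistrib (Fin N₁) (Fin N₂) (Fin M)))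
        ((finSumFinEquiv.prodCongr (Equiv.refl (Fin M))).symm.trans (Equiv.sumProdDistrib (Fin N₁) (Fin N₂) (Fin M)))
        ((X : GL (Fin (N₁ + N₂) × Fin M) 𝔸L) : Matrix (Fin (N₁ + N₂) × Fin M) (Fin (N₁ + N₂) × Fin M) 𝔸L) =
      Matrix.fromBlocks ((X₁ : GL (Fin N₁ × Fin M) 𝔸L) : Matrix (Fin N₁ × Fin M) (Fin N₁ × Fin M) 𝔸L) 0 0 1) :
    inlG L eV dV hdV dW hdW X =
      blkD L eV eA eB dA hdA dB hdB dV hdV hVA hVB dW hdW (inlG L eA dA hdA dW hdW X₁, 1) :=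
  (inlG_eq_blkD L eV eA eB dA hdA dB hdB dV hdV hVA hVB dW hdW X X₁ 1
      (hX.trans (by rw [OneMemClass.coe_one, Units.val_one]))).trans
    (congrArg (fun h₂ => blkD L eV eA eB dA hdA dB hdB dV hdV hVA hVB dW hdW (inlG L eA dA hdA dW hdW X₁, h₂))
      (map_one (inlG L eB dB hdB dW hdW)))

end GroupIdentity

/-! ## §U3 The core: undoubling the doubled conclusion -/

section Core

variable (L : Type) [Field L] [NumberField L] [IsCMField L]

local notation "𝔸L" => AdeleRing (𝓞 L) L
local notation "𝔸⁺" => AdeleRing (𝓞 (Fp L)) (Fp L)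

variable {N₁ N₂ M n n₁ n₂ : ℕ} (eV : Fin (N₁ + N₂) × Fin M ≃ Fin n) (eA : Fin N₁ × Fin M ≃ Fin n₁)
  (eB : Fin N₂ × Fin M ≃ Fin n₂)
  (dA : Fin N₁ → L) (hdA : ∀ i, IsCMField.complexConj L (dA i) = dA i) (hdA0 : ∀ i, dA i ≠ 0)
  (dB : Fin N₂ → L) (hdB : ∀ i, IsCMField.complexConj L (dB i) = dB i) (hdB0 : ∀ i, dB i ≠ 0)
  (dV : Fin (N₁ + N₂) → L) (hdV : ∀ i, IsCMField.complexConj L (dV i) = dV i) (hdV0 : ∀ i, dV i ≠ 0)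
  (hVA : ∀ i, dV (Fin.castAdd N₂ i) = dA i) (hVB : ∀ j, dV (Fin.natAdd N₁ j) = dB j)
  (dW : Fin M → L) (hdW : ∀ i, IsCMField.complexConj L (dW i) = dW i) (hdW0 : ∀ i, dW i ≠ 0)
  (χ : HeckeCharacter L) (hχu : χ.IsUnitary) (hχs : IsSplittingChar L 1 χ)

omit [IsCMField L] in
/-- the test function `T := Θ-witness ⊠_ι Θ-witness` has `T(0) = 1`. [cite: Kudla1994, §2 (doubled space, Siegel parabolic), Thm. 3.1] -/
theorem sumTensor_testVec_zero :
    (sumTensor (Fp L) (idxSplit eV eA eB) (testVec L (n := n₁)) (testVec L (n := n₂)) : (Fin n → 𝔸⁺) → ℂ) 0 = 1 := by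
  rw [coe_sumTensor_apply]
  have h1 : (fun i : Fin n₁ => (0 : Fin n → 𝔸⁺) ((idxSplit eV eA eB).symm (Sum.inl i))) = 0 := rfl
  have h2 : (fun k : Fin n₂ => (0 : Fin n → 𝔸⁺) ((idxSplit eV eA eB).symm (Sum.inr k))) = 0 := rfl
  rw [h1, h2, testVec_zero, testVec_zero, mul_one]

omit [IsCMField L] in
/-- hence `T ≠ 0`. [cite: Kudla1994, §2 (doubled space, Siegel parabolic), Thm. 3.1] -/
theorem sumTensor_testVec_ne_zero :
    sumTensor (Fp L) (idxSplit eV eA eB) (testVec L (n := n₁)) (testVec L (n := n₂)) ≠ 0 := fun h => by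
  have h1 := congrArg (fun Φ : piSchwartzBruhat (Fp L) (Fin n) => (Φ : (Fin n → 𝔸⁺) → ℂ) 0) h
  simp only [sumTensor_testVec_zero, ZeroMemClass.coe_zero, Pi.zero_apply] at h1
  exact one_ne_zero h1

/-- **the undoubling product formula read on the doubled side**: for a continuous `sD` over `ι^𝔻`,
`ω^𝔻(sD (ι_V X)) (R⁻¹(Φ ⊠ Φ′)) = R⁻¹(ω(s X) Φ ⊠ Φ′)` with `s := undouble sD`, `R := R_{e₂⁻¹}` (★ `omega_uD_tensorToSum` +
★ `omega_undoubleIdx_apply`). [cite: Kudla1994, §2 (doubled space, Siegel parabolic), Thm. 3.1] [cite: MoeglinVignerasWaldspurger1987, Chap. 2 II.1] -/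
theorem omegaD_inlG_piSBReindex_symm_tensorToSum {N m : ℕ} (e : Fin N × Fin M ≃ Fin m) (d : Fin N → L)
    (hd : ∀ i, IsCMField.complexConj L (d i) = d i) (hd0 : ∀ i, d i ≠ 0)
    {sD : HA L e d hd dW hdW →* MpD L e d hd dW hdW}
    (hproj : ∀ h, projD L e d hd dW hdW (sD h) = toSpD L e d hd dW hdW h)
    (X : ↥(UnitaryGroup.adelicPair (Fp L) L (IsCMField.complexConj L) N M (Matrix.diagonal d) (Matrix.diagonal dW)))
    (Φ Φ' : piSchwartzBruhat (Fp L) (Fin m)) :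
    adelicMpCont.omega (Fp L) (Fin (m + m)) (gramDA L e d hd dW hdW) (sD (inlG L e d hd dW hdW X))
        ((piSBReindex (Fp L) (finSumFinEquiv (m := m) (n := m)).symm).symm (tensorToSum (Fp L) (Fin m) (Fin m) Φ Φ')) =
      (piSBReindex (Fp L) (finSumFinEquiv (m := m) (n := m)).symm).symm
        (tensorToSum (Fp L) (Fin m) (Fin m)
          (adelicMpCont.omega (Fp L) (Fin m) (gramA L e d hd dW hdW) (undouble L e d hd hd0 dW hdW hdW0 hproj X) Φ) Φ') := by
  have h1 := omega_uD_tensorToSum L e d hd hd0 dW hdW hdW0 hproj X Φ Φ'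
  have h2 := omega_undoubleIdx_apply (e := e) (dV := d) (hdV := hd) dW hdW (sD (inlG L e d hd dW hdW X))
    (tensorToSum (Fp L) (Fin m) (Fin m) Φ Φ')
  -- `uD sD X` is `undoubleIdx (sD (ι X))` by `rfl`
  have h3 : adelicMpCont.omega (Fp L) (Fin m ⊕ Fin m) (gramS L e d hd dW hdW) (uD L e d hd dW hdW sD X) =
      adelicMpCont.omega (Fp L) (Fin m ⊕ Fin m) (gramS L e d hd dW hdW)
        (undoubleIdx L e d hd dW hdW (sD (inlG L e d hd dW hdW X))) := rfl
  rw [LinearEquiv.eq_symm_apply]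
  exact h2.symm.trans ((LinearMap.congr_fun h3 _).symm.trans h1)

include dB hdB hdB0 hVA hVB in
/-- **THE CORE OF (R3).**  For `X ∈ G₁(V)(𝔸) = U(diag dV ⊗ diag dW)(𝔸)` and `X₁ ∈ G₁(V₁)(𝔸)` with `reindex e_Σ e_Σ X = diag(X₁, 1)`
(`X` = "`X₁` on `V₁ ⊗ W`, identity on `V₂ ⊗ W`"), the `χ`-attached compatible splittings satisfy
`ω(s_χ^V X) (Φ₁ ⊠_ι Φ₂) = ω(s_χ^{V₁} X₁) Φ₁ ⊠_ι Φ₂` for ALL `Φ₁, Φ₂` — the doubled conclusion (R1b) at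
`Ψ_j := R⁻¹(Φ_j ⊠ witness)`, undoubled by the two product formulas and `⊠ T`-cancellation.
[cite: Liu2021, Thm. 4.15 proof l. 2199–2210] [cite: Kudla1994, §2 (doubled space, Siegel parabolic), Thm. 3.1] [cite: Kudla1984, §1] -/
theorem omega_chiSplitting_sumTensor_idxSplit
    (X : ↥(UnitaryGroup.adelicPair (Fp L) L (IsCMField.complexConj L) (N₁ + N₂) M (Matrix.diagonal dV) (Matrix.diagonal dW)))
    (X₁ : ↥(UnitaryGroup.adelicPair (Fp L) L (IsCMField.complexConj L) N₁ M (Matrix.diagonal dA) (Matrix.diagonal dW)))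
    (hX : Matrix.reindex
        ((finSumFinEquiv.prodCongr (Equiv.refl (Fin M))).symm.trans (Equiv.sumProdDistrib (Fin N₁) (Fin N₂) (Fin M)))
        ((finSumFinEquiv.prodCongr (Equiv.refl (Fin M))).symm.trans (Equiv.sumProdDistrib (Fin N₁) (Fin N₂) (Fin M)))
        ((X : GL (Fin (N₁ + N₂) × Fin M) 𝔸L) : Matrix (Fin (N₁ + N₂) × Fin M) (Fin (N₁ + N₂) × Fin M) 𝔸L) =
      Matrix.fromBlocks ((X₁ : GL (Fin N₁ × Fin M) 𝔸L) : Matrix (Fin N₁ × Fin M) (Fin N₁ × Fin M) 𝔸L) 0 0 1)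
    (Φ₁ : piSchwartzBruhat (Fp L) (Fin n₁)) (Φ₂ : piSchwartzBruhat (Fp L) (Fin n₂)) :
    adelicMpCont.omega (Fp L) (Fin n) (gramA L eV dV hdV dW hdW)
        (chiSplitting L eV dV hdV hdV0 dW hdW hdW0 χ hχu hχs X) (sumTensor (Fp L) (idxSplit eV eA eB) Φ₁ Φ₂) =
      sumTensor (Fp L) (idxSplit eV eA eB)
        (adelicMpCont.omega (Fp L) (Fin n₁) (gramA L eA dA hdA dW hdW)
          (chiSplitting L eA dA hdA hdA0 dW hdW hdW0 χ hχu hχs X₁) Φ₁) Φ₂ := by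
  have hDV := isDoubledWeilRep_doubledWeilRep L eV dV hdV hdV0 dW hdW hdW0 χ hχu hχs
  have hDA := isDoubledWeilRep_doubledWeilRep L eA dA hdA hdA0 dW hdW hdW0 χ hχu hχs
  have hDB := isDoubledWeilRep_doubledWeilRep L eB dB hdB hdB0 dW hdW hdW0 χ hχu hχs
  -- (K) `ι_V X = blkD (ι_{V₁} X₁, 1)`
  have hK := inlG_eq_blkD_one L eV eA eB dA hdA dB hdB dV hdV hVA hVB dW hdW X X₁ hX
  -- the test functions
  have hT0 := sumTensor_testVec_ne_zero L eV eA eB (n₁ := n₁) (n₂ := n₂)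
  -- (R1b) at `Ψ_j := R⁻¹(Φ_j ⊠ witness)`, `h₁ := ι_{V₁} X₁`, moved to `ι_V X` along `hK`
  have hD := omega_blkD_inl_sumTensor L eV eA eB dA hdA hdA0 dB hdB hdB0 dV hdV hdV0 hVA hVB dW hdW hdW0 χ hχu hχs hDV hDA hDB
    (inlG L eA dA hdA dW hdW X₁)
    ((piSBReindex (Fp L) (finSumFinEquiv (m := n₁) (n := n₁)).symm).symm
      (tensorToSum (Fp L) (Fin n₁) (Fin n₁) Φ₁ (testVec L (n := n₁))))
    ((piSBReindex (Fp L) (finSumFinEquiv (m := n₂) (n := n₂)).symm).symm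
      (tensorToSum (Fp L) (Fin n₂) (Fin n₂) Φ₂ (testVec L (n := n₂))))
  have hKD := (congrArg (fun h => adelicMpCont.omega (Fp L) (Fin (n + n)) (gramDA L eV dV hdV dW hdW)
      (doubledWeilRep L eV dV hdV hdV0 dW hdW hdW0 χ hχu hχs h)
      (sumTensor (Fp L) (idxSplitD eV eA eB)
        ((piSBReindex (Fp L) (finSumFinEquiv (m := n₁) (n := n₁)).symm).symm
          (tensorToSum (Fp L) (Fin n₁) (Fin n₁) Φ₁ (testVec L (n := n₁))))
        ((piSBReindex (Fp L) (finSumFinEquiv (m := n₂) (n := n₂)).symm).symm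
          (tensorToSum (Fp L) (Fin n₂) (Fin n₂) Φ₂ (testVec L (n := n₂)))))) hK).trans hD
  -- the two undoubling product formulas
  have hUA := omegaD_inlG_piSBReindex_symm_tensorToSum L dW hdW hdW0 eA dA hdA hdA0 hDA.proj_eq X₁ Φ₁ (testVec L (n := n₁))
  have hUV := omegaD_inlG_piSBReindex_symm_tensorToSum L dW hdW hdW0 eV dV hdV hdV0 hDV.proj_eq X
    (sumTensor (Fp L) (idxSplit eV eA eB) Φ₁ Φ₂) (sumTensor (Fp L) (idxSplit eV eA eB) (testVec L (n := n₁)) (testVec L (n := n₂)))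
  -- LHS: the shuffle, then the product formula of `V`
  have hL := (congrArg (adelicMpCont.omega (Fp L) (Fin (n + n)) (gramDA L eV dV hdV dW hdW)
      (doubledWeilRep L eV dV hdV hdV0 dW hdW hdW0 χ hχu hχs (inlG L eV dV hdV dW hdW X)))
      (sumTensor_idxSplitD_tensorToSum (Fp L) eV eA eB Φ₁ (testVec L (n := n₁)) Φ₂ (testVec L (n := n₂)))).trans hUV
  -- RHS: the product formula of `V₁`, then the shuffle
  have hR := (congrArg (fun Ψ => sumTensor (Fp L) (idxSplitD eV eA eB) Ψ
      ((piSBReindex (Fp L) (finSumFinEquiv (m := n₂) (n := n₂)).symm).symm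
        (tensorToSum (Fp L) (Fin n₂) (Fin n₂) Φ₂ (testVec L (n := n₂))))) hUA).trans
    (sumTensor_idxSplitD_tensorToSum (Fp L) eV eA eB _ (testVec L (n := n₁)) Φ₂ (testVec L (n := n₂)))
  -- compare and cancel
  have h := (hL.symm.trans hKD).trans hR
  exact tensorToSum_left_cancel hT0 ((piSBReindex (Fp L) (finSumFinEquiv (m := n) (n := n)).symm).symm.injective h)

end Core

end Literature.NumberTheory.GelbartRogawski1991.GRConstruction

end
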